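import Summits.ABC.ABC.Theses.IneffectiveSubspace

/-!
# Crux `DeepRegimeABC` (stmt-ABC-15121) — crux-ideate round 2, ideator 5: Sketch

Idea card `ridout-core-exhaustion`.  Fixed-place Roth–Ridout (Bombieri–Gubler Thm 6.2.3 over `ℚ`,
targets in `{0, 1, ∞}` at the primes `p ≤ y` and at `∞`, one application per target pattern) bounds every
abc triple whose CORE MASS `M_y(a,b,c) := Σ_{p ≤ y} v_p(abc)·log p + log (c / min(a,b))` is at least
`(2+δ)·log c`.  Hence the crux is equivalent (modulo that theorem) to its CORELESS form, in which the prover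
may additionally assume `M_y < (2+δ) log c` for `y, δ` of his own choosing; since
`Σ_p v_p(abc) log p + log(c/min(a,b)) ≥ 2 log c`, coreless triples carry `> (1-δ)·log c` of `abc`-mass on
primes `> y`, and a coreless violator of quality `≥ 1+ε` carries a `y`-rough POWERFUL excess `≥ c^{ε-δ-O(ε²)}`.

Contents (all over existing declarations; namespace of this crux):
* `coreMass`, `roughMass`, `depth5`; `coreMass_add_roughMass` and `roughMass_gt_of_coreless` (PROVED):
  a coreless triple (`M_y < (2+δ) log c`) has `y`-rough mass `R_y > (1-δ) log c - log 2`;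
* `RidoutCoreBound`  — the fixed-place Ridout input in abc currency (stub 1 of the line; provable from an
  `hRat`-shaped hypothesis as in `Literature.NumberTheory.DiophantineApproximation.padicRoth_int_of_rat`);
* `CorelessTailABC`  — the coreless form of the crux (stub 2, the open one);
* `deepRegimeABC_of_coreless : RidoutCoreBound → CorelessTailABC → DeepRegimeABC` (PROVED);
* `corelessTailABC_of_deepRegimeABC : DeepRegimeABC → CorelessTailABC` (PROVED, trivial direction).
-/

set_option linter.dupNamespace false

namespace Summit.ABC.ABC.Cruxes.DeepRegimeABC.RidoutCore

open Literature.NumberTheory.DiophantineGeometry UniqueFactorizationMonoid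
open Summit.ABC.ABC.Theses.IneffectiveSubspace

/-- The depth-5 count `ω₅(abc) = #{p : p⁵ ∣ abc}` exactly as in the crux. -/
noncomputable def depth5 (a b c : ℕ) : ℕ :=
  ((a * b * c).primeFactors.filter (fun p => 5 ≤ (a * b * c).factorization p)).card

/-- Ridout CORE MASS of `(a,b,c)` on the places `{p ≤ y} ∪ {∞}`:
`M_y(a,b,c) = Σ_{p ≤ y, p ∣ abc} v_p(abc)·log p + log (c / min(a,b))`
(the archimedean term is the proximity of `a/c` to the nearer of the two targets `0, 1`). -/
noncomputable def coreMass (y : ℕ) (a b c : ℕ) : ℝ :=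
  (∑ p ∈ (a * b * c).primeFactors.filter (fun p => p ≤ y),
      ((a * b * c).factorization p : ℝ) * Real.log p)
    + Real.log ((c : ℝ) / ((min a b : ℕ) : ℝ))

/-- The `y`-ROUGH mass of `abc`: `Σ_{p > y, p ∣ abc} v_p(abc)·log p`. -/
noncomputable def roughMass (y : ℕ) (a b c : ℕ) : ℝ :=
  ∑ p ∈ (a * b * c).primeFactors.filter (fun p => ¬ p ≤ y),
      ((a * b * c).factorization p : ℝ) * Real.log p

/-- `log n = Σ_{p ∣ n} v_p(n) log p`. -/
theorem log_eq_sum_factorization {n : ℕ} (hn : n ≠ 0) :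
    Real.log n = ∑ p ∈ n.primeFactors, (n.factorization p : ℝ) * Real.log p := by
  have hprod : (n : ℝ) = ∏ p ∈ n.primeFactors, ((p : ℝ) ^ (n.factorization p)) := by
    conv_lhs => rw [← Nat.prod_factorization_pow_eq_self hn]
    rw [Finsupp.prod, Nat.support_factorization]
    push_cast
    rfl
  rw [hprod, Real.log_prod]
  · refine Finset.sum_congr rfl fun p _ => ?_
    rw [Real.log_pow]
  · intro p hp
    have hp0 : (p : ℝ) ≠ 0 := by exact_mod_cast (Nat.prime_of_mem_primeFactors hp).ne_zero
    exact pow_ne_zero _ hp0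

/-- Core + rough = total: `M_y + R_y = log(abc) + log(c / min(a,b))`. -/
theorem coreMass_add_roughMass (y a b c : ℕ) (habc : a * b * c ≠ 0) :
    coreMass y a b c + roughMass y a b c =
      Real.log ((a * b * c : ℕ) : ℝ) + Real.log ((c : ℝ) / ((min a b : ℕ) : ℝ)) := by
  unfold coreMass roughMass
  rw [log_eq_sum_factorization habc, add_right_comm,
    Finset.sum_filter_add_sum_filter_not]

/-- **Coreless ⟹ rough-heavy.** For an abc triple with core mass `< (2+δ)·log c` the `y`-rough part of
`abc` carries more than `(1-δ)·log c - log 2`:  `R_y > (1-δ) log c - log 2`.  (Indeed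
`log(abc) + log(c/min(a,b)) = log(max(a,b)) + 2 log c ≥ 2 log c + log(c/2)`.) -/
theorem roughMass_gt_of_coreless {y a b c : ℕ} {δ : ℝ} (habc : IsABCTriple a b c)
    (hcore : coreMass y a b c < (2 + δ) * Real.log c) :
    (1 - δ) * Real.log c - Real.log 2 < roughMass y a b c := by
  obtain ⟨ha, hb, hsum, -⟩ := habc
  have hc : 0 < c := by omega
  have habc0 : a * b * c ≠ 0 := by positivity
  have hid := coreMass_add_roughMass y a b c habc0
  -- log(abc) + log(c/min) = log(max a b) + 2 log c
  have hmin0 : (0 : ℝ) < ((min a b : ℕ) : ℝ) := by exact_mod_cast lt_min ha hb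
  have hmax0 : (0 : ℝ) < ((max a b : ℕ) : ℝ) := by exact_mod_cast lt_max_of_lt_left ha
  have hcR : (0 : ℝ) < (c : ℝ) := by exact_mod_cast hc
  set m : ℝ := ((min a b : ℕ) : ℝ) with hm
  set M : ℝ := ((max a b : ℕ) : ℝ) with hM
  have hminmax : m * M = (a : ℝ) * b := by
    rcases le_total a b with h | h
    · simp [hm, hM, min_eq_left h, max_eq_right h]
    · simp [hm, hM, min_eq_right h, max_eq_left h, mul_comm]
  have habcR : ((a * b * c : ℕ) : ℝ) = (a : ℝ) * b * c := by push_cast; ring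
  have hkey : Real.log ((a * b * c : ℕ) : ℝ) + Real.log ((c : ℝ) / m) =
      Real.log M + 2 * Real.log c := by
    have hprod : ((a * b * c : ℕ) : ℝ) * ((c : ℝ) / m) = M * (c : ℝ) ^ 2 := by
      rw [habcR, ← hminmax]
      field_simp
    rw [← Real.log_mul (by positivity) (by positivity), hprod,
      Real.log_mul (by positivity) (by positivity), Real.log_pow]
    push_cast
    ring
  -- max a b ≥ c/2, i.e. log(max) ≥ log c - log 2
  have hmaxge : (c : ℝ) / 2 ≤ ((max a b : ℕ) : ℝ) := by
    have : (c : ℝ) ≤ 2 * ((max a b : ℕ) : ℝ) := by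
      have h1 : (a : ℝ) ≤ ((max a b : ℕ) : ℝ) := by exact_mod_cast le_max_left a b
      have h2 : (b : ℝ) ≤ ((max a b : ℕ) : ℝ) := by exact_mod_cast le_max_right a b
      have h3 : (c : ℝ) = a + b := by exact_mod_cast hsum.symm
      linarith
    linarith
  have hlogmax : Real.log c - Real.log 2 ≤ Real.log ((max a b : ℕ) : ℝ) := by
    rw [← Real.log_div hcR.ne' (by norm_num)]
    exact Real.log_le_log (by positivity) hmaxge
  linarith [hid, hkey, hlogmax]


/-- **RidoutCoreBound** (stub 1; fixed-place `p`-adic Roth in abc currency).  For every `y` and `δ > 0`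
the abc triples with core mass `M_y(a,b,c) ≥ (2+δ)·log c` are bounded.  Source: Ridout 1958 =
Bombieri–Gubler 2006 Thm 6.2.3 (`K = ℚ`, `S = {p ≤ y} ∪ {∞}`, `κ = 2+δ`), applied once for each of
the finitely many target patterns `{p ≤ y} → {0,1,∞}`, `∞ → {0,1}` (the pattern of a triple: `0` at
`p ∣ a`, `1` at `p ∣ b`, `∞` at `p ∣ c`; `β = a/c`, `H(β) = c`, and
`min(1,|β|_p)·… = exp(-M_y)`); ineffective `B` — allowed. -/
def RidoutCoreBound : Prop :=
  ∀ y : ℕ, ∀ δ : ℝ, 0 < δ → ∃ B : ℝ, ∀ a b c : ℕ, IsABCTriple a b c →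
    (2 + δ) * Real.log c ≤ coreMass y a b c → (c : ℝ) ≤ B

/-- **CorelessTailABC** (stub 2, the open one).  The crux for CORELESS triples only, the prover
choosing the core parameters `y, δ` as functions of `ε`. -/
def CorelessTailABC : Prop :=
  ∀ ε : ℝ, 0 < ε → ∃ y : ℕ, ∃ δ : ℝ, 0 < δ ∧ ∃ K : ℕ, ∃ C : ℝ, 0 < C ∧
    ∀ a b c : ℕ, IsABCTriple a b c → K ≤ depth5 a b c →
      coreMass y a b c < (2 + δ) * Real.log c →
      (c : ℝ) < C * ((rad a b c : ℕ) : ℝ) ^ (1 + ε)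

/-- `rad(abc)^(1+ε) ≥ 1`. -/
theorem one_le_rad_rpow (a b c : ℕ) {ε : ℝ} (hε : 0 < ε) :
    (1 : ℝ) ≤ ((rad a b c : ℕ) : ℝ) ^ (1 + ε) := by
  have h1 : (1 : ℝ) ≤ ((rad a b c : ℕ) : ℝ) := by
    rw [rad_def]
    exact_mod_cast Nat.pos_of_ne_zero radical_ne_zero
  exact Real.one_le_rpow h1 (by linarith)

/-- **The line's composition (PROVED):** fixed-place Ridout + the coreless tail give the crux, by a case
split on the core mass and absorption of the bounded (cored) triples into the constant. -/
theorem deepRegimeABC_of_coreless (hR : RidoutCoreBound) (hC : CorelessTailABC) :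
    Summit.ABC.ABC.Theses.IneffectiveSubspace.DeepRegimeABC := by
  intro ε hε
  obtain ⟨y, δ, hδ, K, C, hC0, h⟩ := hC ε hε
  obtain ⟨B, hB⟩ := hR y δ hδ
  refine ⟨K, max C (B + 1), lt_max_of_lt_left hC0, fun a b c habc hK => ?_⟩
  have hrad1 : (1 : ℝ) ≤ ((rad a b c : ℕ) : ℝ) ^ (1 + ε) := one_le_rad_rpow a b c hε
  have hrad0 : (0 : ℝ) ≤ ((rad a b c : ℕ) : ℝ) ^ (1 + ε) := le_trans zero_le_one hrad1
  have hmax0 : (0 : ℝ) ≤ max C (B + 1) := le_trans hC0.le (le_max_left _ _)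
  by_cases hcore : coreMass y a b c < (2 + δ) * Real.log c
  · calc (c : ℝ) < C * ((rad a b c : ℕ) : ℝ) ^ (1 + ε) := h a b c habc hK hcore
      _ ≤ max C (B + 1) * ((rad a b c : ℕ) : ℝ) ^ (1 + ε) :=
          mul_le_mul_of_nonneg_right (le_max_left _ _) hrad0
  · have hcB : (c : ℝ) ≤ B := hB a b c habc (not_lt.mp hcore)
    calc (c : ℝ) ≤ B := hcB
      _ < B + 1 := by linarith
      _ ≤ max C (B + 1) := le_max_right _ _
      _ = max C (B + 1) * 1 := (mul_one _).symm
      _ ≤ max C (B + 1) * ((rad a b c : ℕ) : ℝ) ^ (1 + ε) :=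
          mul_le_mul_of_nonneg_left hrad1 hmax0

/-- The trivial direction: the crux implies its coreless form (ignore the extra hypothesis). -/
theorem corelessTailABC_of_deepRegimeABC
    (h : Summit.ABC.ABC.Theses.IneffectiveSubspace.DeepRegimeABC) : CorelessTailABC := by
  intro ε hε
  obtain ⟨K, C, hC, hK⟩ := h ε hε
  exact ⟨2, 1, one_pos, K, C, hC, fun a b c habc hKle _ => hK a b c habc hKle⟩

end Summit.ABC.ABC.Cruxes.DeepRegimeABC.RidoutCore
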